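import Mathlib.Analysis.SpecialFunctions.Trigonometric.Basic
import Mathlib.Analysis.SpecialFunctions.Pow.Real

/-!
# Sine modes of an `N`-layer stack (tridiagonal Toeplitz / path-graph spectrum)

The one-particle problem of `N` identical planes (on-site energy `ε`) coupled to their nearest
neighbours in the stack by `t⊥` — the object behind the "`N`-layer cuprate / nickelate ↦ `N`
split bands" bookkeeping (bilayer `ε ± t⊥`, trilayer `ε, ε ± √2 t⊥`, quintuple layer …) — is the
`N × N` tridiagonal Toeplitz matrix `T_N(t⊥, ε, t⊥)`.  Its eigenvalues and eigenvectors are the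
classical path-graph ones [VanMieghem2010, §6.4 Eqs. (6.8)–(6.10)]:
`λ_m = ε + 2 t⊥ cos(π m/(N+1))`, `(x_m)_k = sin(π m k/(N+1))`, `m, k = 1, …, N`.

This file proves the statement in the form every user needs and with no linear-algebra
packaging: the sine mode `stackMode N m k = sin(π m k/(N+1))` VANISHES at the two virtual
boundary sites `k = 0` and `k = N + 1` (`stackMode_zero`, `stackMode_boundary`) and satisfies the
three-term (Dirichlet) eigen-equation
`t·u(k) + ε·u(k+1) + t·u(k+2) = (ε + 2t cos(π m/(N+1)))·u(k+1)` for EVERY `k`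
(`stackMode_recurrence`), hence on the sites `1 … N` with the boundary terms dropped
(`stackApply_modeVec`: the `N`-site stack operator written pointwise on `Fin N → ℝ` applied to
the mode is the mode times `ε + 2t cos(π m/(N+1))`).  The modes are non-trivial for
`1 ≤ m ≤ N` (`stackMode_one_ne_zero`).  The familiar special cases are recorded as the values
`2cos(π/3) = 1` (bilayer, `N = 2`: `ε ± t`), `2cos(π/4) = √2` (trilayer, `N = 3`: `ε ± √2 t, ε`;
cf. `TrilayerSplittingIdentities.lean`), `2cos(π/6) = √3` (quintuple layer, `N = 5`:
`ε ± √3 t, ε ± t, ε`).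

Everything is a proved theorem; no named facts, no axioms beyond Mathlib's, no `sorry`.  Not
here: completeness/orthogonality of the `N` modes, inequivalent outer planes, `k`-dependent
`t⊥(k)`.

Reference: P. Van Mieghem, *Graph Spectra for Complex Networks* (CUP 2010), §6.4, Eqs. (6.7)–
(6.10) (tridiagonal Toeplitz matrix `T_N(a,b,c)`: `λ_m = b + 2√(ac) cos(πm/(N+1))`,
`(x_m)_k ∝ sin(πmk/(N+1))`).  AI-produced formalisation (H21, cell hubbard-downfold, seat lit-2,
2026-08-27).
-/

namespace Literature.MathematicalPhysics.QuantumLattice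

open Real

noncomputable section

/-- The `m`-th sine mode of an `N`-site open chain, evaluated at (integer) site `k`:
`sin(π m k/(N+1))`; sites `1 … N` are physical, `0` and `N+1` are the virtual boundary sites.
[cite: VanMieghem2010, §6.4 Eq. (6.9)] -/
def stackMode (N m k : ℕ) : ℝ := sin (π * m * k / (N + 1))

/-- Unfolding. [cite: VanMieghem2010, §6.4 Eq. (6.9)] -/
theorem stackMode_def (N m k : ℕ) : stackMode N m k = sin (π * m * k / (N + 1)) := rfl

/-- Dirichlet boundary at the virtual site `0`. [cite: VanMieghem2010, §6.4 Eq. (6.9)] -/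
@[simp] theorem stackMode_zero (N m : ℕ) : stackMode N m 0 = 0 := by
  simp [stackMode_def]

/-- Dirichlet boundary at the virtual site `N + 1`: `sin(π m) = 0`.
[cite: VanMieghem2010, §6.4 Eq. (6.9)] -/
@[simp] theorem stackMode_boundary (N m : ℕ) : stackMode N m (N + 1) = 0 := by
  rw [stackMode_def]
  have h : (π * m * ((N + 1 : ℕ) : ℝ) / (N + 1) : ℝ) = (m : ℝ) * π := by
    push_cast
    field_simp
  rw [h]
  exact sin_nat_mul_pi m

/-- The trigonometric three-term identity behind the whole file:
`sin(a − θ) + sin(a + θ) = 2 cos θ · sin a`. [cite: VanMieghem2010, §6.4 Eq. (6.8)] -/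
theorem sin_sub_add_sin_add (a θ : ℝ) : sin (a - θ) + sin (a + θ) = 2 * cos θ * sin a := by
  rw [sin_sub, sin_add]; ring

/-- **Eigen-equation (three-term recurrence)**: for every site index `k`,
`t·u(k) + ε·u(k+1) + t·u(k+2) = (ε + 2t cos(πm/(N+1)))·u(k+1)` with `u = stackMode N m`.
[cite: VanMieghem2010, §6.4 Eqs. (6.8)–(6.9)] -/
theorem stackMode_recurrence (N m k : ℕ) (ε t : ℝ) :
    t * stackMode N m k + ε * stackMode N m (k + 1) + t * stackMode N m (k + 2)
      = (ε + 2 * t * cos (π * m / (N + 1))) * stackMode N m (k + 1) := by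
  simp only [stackMode_def]
  set θ : ℝ := π * m / (N + 1) with hθ
  have e0 : (π * m * (k : ℕ) / (N + 1) : ℝ) = θ * (k + 1) - θ := by
    rw [hθ]; ring
  have e1 : (π * m * ((k + 1 : ℕ) : ℝ) / (N + 1) : ℝ) = θ * (k + 1) := by
    rw [hθ]; push_cast; ring
  have e2 : (π * m * ((k + 2 : ℕ) : ℝ) / (N + 1) : ℝ) = θ * (k + 1) + θ := by
    rw [hθ]; push_cast; ring
  rw [e0, e1, e2]
  have h3 := sin_sub_add_sin_add (θ * (k + 1)) θ
  calc t * sin (θ * (k + 1) - θ) + ε * sin (θ * (k + 1)) + t * sin (θ * (k + 1) + θ)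
      = ε * sin (θ * (k + 1)) + t * (sin (θ * (k + 1) - θ) + sin (θ * (k + 1) + θ)) := by ring
    _ = (ε + 2 * t * cos θ) * sin (θ * (k + 1)) := by rw [h3]; ring

/-- The modes are non-trivial: `u(1) = sin(π m/(N+1)) ≠ 0` for `1 ≤ m ≤ N` (indeed `> 0`).
[cite: VanMieghem2010, §6.4 Eq. (6.9)] -/
theorem stackMode_one_pos {N m : ℕ} (hm : 1 ≤ m) (hmN : m ≤ N) : 0 < stackMode N m 1 := by
  rw [stackMode_def]
  have hN : (0 : ℝ) < (N : ℝ) + 1 := by positivity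
  apply sin_pos_of_pos_of_lt_pi
  · have : (0 : ℝ) < m := by exact_mod_cast hm
    positivity
  · rw [div_lt_iff₀ hN]
    have hm' : (m : ℝ) ≤ N := by exact_mod_cast hmN
    push_cast
    nlinarith [pi_pos]

/-- Corollary: `stackMode N m 1 ≠ 0` for `1 ≤ m ≤ N`. [cite: VanMieghem2010, §6.4 Eq. (6.9)] -/
theorem stackMode_one_ne_zero {N m : ℕ} (hm : 1 ≤ m) (hmN : m ≤ N) : stackMode N m 1 ≠ 0 :=
  (stackMode_one_pos hm hmN).ne'

/-! ## The `N`-site stack operator on `Fin N → ℝ` and its sine eigenvectors -/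

/-- The `N`-layer stack operator (tridiagonal Toeplitz `T_N(t, ε, t)`) written pointwise: on-site
`ε`, coupling `t` to the layer above and below, open (Dirichlet) ends.
[cite: VanMieghem2010, §6.4 Eq. (6.7)] -/
def stackApply (N : ℕ) (ε t : ℝ) (v : Fin N → ℝ) (i : Fin N) : ℝ :=
  ε * v i
    + t * (if h : i.val + 1 < N then v ⟨i.val + 1, h⟩ else 0)
    + t * (if h : 0 < i.val then v ⟨i.val - 1, by omega⟩ else 0)

/-- The `m`-th mode as a vector on the physical sites `1 … N` (site `i : Fin N` ↦ `k = i + 1`).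
[cite: VanMieghem2010, §6.4 Eq. (6.9)] -/
def modeVec (N m : ℕ) : Fin N → ℝ := fun i => stackMode N m (i.val + 1)

/-- **The sine modes are eigenvectors of the `N`-layer stack**:
`T_N(t, ε, t) x_m = (ε + 2t cos(πm/(N+1))) x_m`.  (Non-triviality: `stackMode_one_ne_zero`.)
[cite: VanMieghem2010, §6.4 Eqs. (6.8)–(6.10)] -/
theorem stackApply_modeVec (N m : ℕ) (ε t : ℝ) :
    stackApply N ε t (modeVec N m) = (ε + 2 * t * cos (π * m / (N + 1))) • modeVec N m := by
  funext i
  simp only [stackApply, modeVec, Pi.smul_apply, smul_eq_mul]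
  have key := stackMode_recurrence N m i.val ε t
  -- the `k + 2` neighbour: present iff `i + 1 < N`, else it is the boundary site `N + 1`
  have up : (if h : i.val + 1 < N then stackMode N m ((⟨i.val + 1, h⟩ : Fin N).val + 1) else 0)
      = stackMode N m (i.val + 2) := by
    split_ifs with h
    · rfl
    · have hi : i.val + 2 = N + 1 := by omega
      rw [hi, stackMode_boundary]
  -- the `k` neighbour: present iff `0 < i`, else it is the boundary site `0`
  have dn : (if h : 0 < i.val then stackMode N m ((⟨i.val - 1, by omega⟩ : Fin N).val + 1) else 0)
      = stackMode N m i.val := by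
    split_ifs with h
    · congr 1
      simp only
      omega
    · have hi : i.val = 0 := by omega
      rw [hi, stackMode_zero]
  rw [up, dn]
  linarith [key]

/-! ## The familiar splittings: `2cos(π/3) = 1`, `2cos(π/4) = √2`, `2cos(π/6) = √3` -/

/-- Bilayer (`N = 2`): the splitting factor `2cos(π/3) = 1`, i.e. levels `ε ± t`.
[cite: VanMieghem2010, §6.4 Eq. (6.10)] -/
theorem two_mul_cos_pi_div_three : 2 * cos (π / 3) = 1 := by
  rw [cos_pi_div_three]; ring

/-- Trilayer (`N = 3`): `2cos(π/4) = √2` (levels `ε ± √2 t` and `ε`, since `cos(π/2) = 0`).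
[cite: VanMieghem2010, §6.4 Eq. (6.10)] -/
theorem two_mul_cos_pi_div_four : 2 * cos (π / 4) = sqrt 2 := by
  rw [cos_pi_div_four]; ring

/-- Quintuple layer (`N = 5`): `2cos(π/6) = √3` (levels `ε ± √3 t`, `ε ± t`, `ε`).
[cite: VanMieghem2010, §6.4 Eq. (6.10)] -/
theorem two_mul_cos_pi_div_six : 2 * cos (π / 6) = sqrt 3 := by
  rw [cos_pi_div_six]; ring

/-- The middle mode of an odd stack has eigenvalue exactly `ε`: for `N = 2j + 1`, `m = j + 1`,
`cos(π m/(N+1)) = cos(π/2) = 0` — the "non-bonding" band of a trilayer / quintuple layer.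
[cite: VanMieghem2010, §6.4 Eq. (6.10)] -/
theorem cos_middle_mode (j : ℕ) : cos (π * ((j + 1 : ℕ) : ℝ) / ((2 * j + 1 : ℕ) + 1)) = 0 := by
  have h : (π * ((j + 1 : ℕ) : ℝ) / ((2 * j + 1 : ℕ) + 1) : ℝ) = π / 2 := by
    push_cast
    field_simp
    ring
  rw [h, cos_pi_div_two]

/-- Mirror symmetry of the spectrum: `cos(π(N+1−m)/(N+1)) = −cos(πm/(N+1))`, i.e.
`λ_{N+1−m} − ε = −(λ_m − ε)`. [cite: VanMieghem2010, §6.4 after Eq. (6.10)] -/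
theorem cos_mirror_mode (N m : ℕ) (hm : m ≤ N + 1) :
    cos (π * ((N + 1 - m : ℕ) : ℝ) / (N + 1)) = -cos (π * m / (N + 1)) := by
  have hN : (N : ℝ) + 1 ≠ 0 := by positivity
  have h : (π * ((N + 1 - m : ℕ) : ℝ) / (N + 1) : ℝ) = π - π * m / (N + 1) := by
    rw [Nat.cast_sub hm]
    push_cast
    field_simp
  rw [h, cos_pi_sub]

end

end Literature.MathematicalPhysics.QuantumLattice
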